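import Literature.NumberTheory.Automorphic.ArtinLFunctions
import Literature.NumberTheory.Automorphic.LanglandsTunnell
import Literature.NumberTheory.EllipticCurves.CuspFormLFunctionProofs
import HarnessLib

/-!
# Langlands–Tunnell, Artin side: the reduction to lang.S30 and Deligne–Serre (proved)
(companion to `Literature.NumberTheory.Automorphic.ArtinLFunctions`)

The named fact `Literature.NumberTheory.Automorphic.langlands_tunnell_hasEntireContinuation` of `ArtinLFunctions` (an odd
irreducible continuous `ρ : Γ_ℚ → GL_2(ℂ)` with solvable image has entire Artin L-function;
Langlands, *Base Change for GL(2)* (1980), §3; Tunnell, Bull. AMS 5 (1981), Theorem) is, as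
its docstring says, the Artin-side corollary of the Langlands–Tunnell theorem lang.S30.  This
file proves that corollary *as an implication* from the two named facts of
`Literature.NumberTheory.Automorphic.LanglandsTunnell` that make up the printed argument over
`ℚ`, together with Hecke's theorem for weight-one cusp forms, which the tree already proves:

* `Literature.Lang.langlands_tunnell ρ` (**named fact**, lang.S30: `ρ` arises from a weight-one
  newform `f ∈ S_1(Γ₁(N))`, `IsGaloisRepOfNewform1`);
* `Literature.NumberTheory.Automorphic.artinLFunction_eq_cuspFormLSeries` (**named fact**, Deligne–Serre 1974, Thm. 4.1
  with Thm. 4.6 (b): `L(s, ρ) = L(s, f)` on `re s > 1` for `ρ` attached to the newform `f`);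
* `Literature.NumberTheory.Automorphic.ModularForms.hasEntireContinuation_cuspFormLSeries_of_weight_one` (**proved** here from
  the tree's `exists_differentiable_eq_cuspFormLSeries_of_lt_re`, Hecke 1936 + Rankin: for
  `f ∈ S_1(Γ₁(N))` some entire function agrees with `L(s, f) = ∑ aₙ n^{-s}` on
  `re s > (k + 1)/2 = 1`, which is exactly the threshold of `LFunction.HasEntireContinuation`).

Hence `langlands_tunnell_hasEntireContinuation_of_langlands_tunnell` (**proved**):
`(∀ ρ, langlands_tunnell ρ) → (∀ N f ρ, artinLFunction_eq_cuspFormLSeries) →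
langlands_tunnell_hasEntireContinuation`, and the same for the tagged twin
`hasEntireContinuation_artinLFunction_of_isSolvable ρ` of `LanglandsTunnell`
(`langlands_tunnell_hasEntireContinuation_iff_forall`: the two facts are the same statement,
`ρ.toGaloisRep.IsIrreducible` being definitionally `FramedRep.IsIrreducible ρ`).

The unconditional `langlands_tunnell_hasEntireContinuation_holds` is **not** in reach: it needs
the automorphy statement lang.S30 itself (cyclic base change for `GL(2)` via the trace formula,
the Gelbart–Jacquet lift, the Jacquet–Piatetski-Shapiro–Shalika non-normal cubic base change and
the converse theorem), none of which has a Lean substrate.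

## References

* J. Tunnell, *Artin's conjecture for representations of octahedral type*, Bull. AMS (N.S.) 5
  (1981), 173–175: p. 173 ("when `π = π(ρ)` the L-series of `π` and `ρ` agree, and since
  cuspidal representations have entire L-series, Artin's conjecture follows"), Theorem p. 175
  (`Tunnell1981`).
* R. P. Langlands, *Base Change for GL(2)*, Ann. of Math. Studies 96 (1980), §3
  (`LanglandsBaseChange1980`).
* P. Deligne, J.-P. Serre, *Formes modulaires de poids 1*, Ann. Sci. ÉNS 7 (1974), Thm. 4.1,
  Thm. 4.6 (`DeligneSerreASENS1974`).
* S. Gelbart, *Three lectures on the modularity of `ρ̄_{E,3}` and the Langlands reciprocity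
  conjecture*, in: Modular Forms and Fermat's Last Theorem (1997), Thm. 1.3 and Thm. 2.6
  (`Gelbart1997`).
* F. Diamond, J. Shurman, *A first course in modular forms*, GTM 228 (2005), Thm. 5.10.2
  (`DiamondShurman2005`).
-/

noncomputable section

open scoped MatrixGroups ModularForm NumberField

open CongruenceSubgroup

namespace Literature.NumberTheory.Automorphic

namespace ModularForms

/-- **Hecke** (weight one).  For a cusp form `f` of weight `1` on `Γ₁(N)`, `N ≥ 1`, there is an entire
function agreeing with `L(s, f) = ∑_{n ≥ 1} aₙ(f) n^{-s}` (`cuspFormLSeries f`) on `re s > 1`,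
i.e. `cuspFormLSeries f` has entire continuation in the sense of
`Literature.NumberTheory.GaloisRepresentations.LFunction.HasEntireContinuation` (threshold `re s > 1`).  This is the case `k = 1`,
`Γ = Γ₁(N)` (cusp width `1` at `∞`, Mathlib `CongruenceSubgroup.strictWidthInfty_Gamma1`) of
the tree's `exists_differentiable_eq_cuspFormLSeries_of_lt_re` (Hecke 1936; Rankin 1977,
Thm. 4.5.2; Diamond–Shurman Thm. 5.10.2), whose half-plane `re s > (k + 1)/2` is `re s > 1`
for `k = 1`. [cite: DiamondShurman2005, Thm. 5.10.2] -/
theorem hasEntireContinuation_cuspFormLSeries_of_weight_one {N : ℕ} [NeZero N]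
    (f : CuspForm (Gamma1 N) 1) :
    GaloisRepresentations.LFunction.HasEntireContinuation (EllipticCurves.ModularForms.cuspFormLSeries f) := by
  obtain ⟨L, hL, hLeq⟩ :=
    EllipticCurves.ModularForms.exists_differentiable_eq_cuspFormLSeries_of_lt_re (strictWidthInfty_Gamma1 N) f
  refine ⟨L, hL, fun s hs => hLeq s ?_⟩
  push_cast
  linarith

end ModularForms

section Lang

open EllipticCurves.ModularForms ModularForms

/-- **Deligne–Serre + Hecke** (the "hence" step over `ℚ`).  If the continuous representation
`ρ : Γ_ℚ → GL_2(ℂ)` is attached away from `N` to a weight-one newform `f ∈ S_1(Γ₁(N))`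
(`IsNewform1 f`, `IsGaloisRepOfNewform1 f _ {p ∣ N} ρ`), then — granting the Deligne–Serre
comparison `artinLFunction_eq_cuspFormLSeries` (`L(s, ρ) = L(s, f)` on `re s > 1`; Deligne–Serre
1974, Thm. 4.1 with Thm. 4.6 (b)) — the Artin L-function of `ρ` has entire continuation, by
Hecke's theorem for `f` (`hasEntireContinuation_cuspFormLSeries_of_weight_one`).
[cite: DeligneSerreASENS1974, Thm. 4.1 and Thm. 4.6 (b)] [cite: DiamondShurman2005, Thm. 5.10.2] -/
theorem hasEntireContinuation_artinLFunction_of_isGaloisRepOfNewform1 {N : ℕ} [NeZero N]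
    {f : CuspForm (Gamma1 N) 1} {ρ : GaloisRepresentations.FramedArtinRep ℚ 2}
    (hDS : artinLFunction_eq_cuspFormLSeries (f := f) (ρ := ρ)) (hf : IsNewform1 f)
    (hρ : IsGaloisRepOfNewform1 f (algebraMap (coeffCharField f) ℂ) {p | p ∣ N} ρ) :
    GaloisRepresentations.LFunction.HasEntireContinuation (GaloisRepresentations.artinLFunction ρ.toArtinRep) := by
  obtain ⟨L, hL, hLeq⟩ := hasEntireContinuation_cuspFormLSeries_of_weight_one f
  exact ⟨L, hL, fun s hs => (hLeq s hs).trans (hDS hf hρ s hs).symm⟩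

/-- **Langlands–Tunnell, Artin side, from lang.S30** (Tunnell 1981, p. 173: "when `π = π(ρ)`
the L-series of `π` and `ρ` agree, and since cuspidal representations have entire L-series,
Artin's conjecture follows"; over `ℚ` and for odd `ρ`, via the weight-one newform of
Gelbart 1997, Thm. 1.3 / Thm. 2.6).  The named fact
`langlands_tunnell_hasEntireContinuation` follows from the Langlands–Tunnell modularity
statement `langlands_tunnell` (lang.S30) for every `ρ`, the Deligne–Serre comparison
`artinLFunction_eq_cuspFormLSeries` for every level, newform and `ρ`, and Hecke's theorem
(proved).  Both hypotheses are named facts of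
`Literature.NumberTheory.Automorphic.LanglandsTunnell`. [cite: Tunnell1981, Theorem]
[cite: Gelbart1997, Thm. 1.3] [cite: DeligneSerreASENS1974, Thm. 4.1 and Thm. 4.6 (b)] -/
theorem langlands_tunnell_hasEntireContinuation_of_langlands_tunnell
    (hLT : ∀ ρ : GaloisRepresentations.FramedArtinRep ℚ 2, langlands_tunnell ρ)
    (hDS : ∀ {N : ℕ} [NeZero N] {f : CuspForm (Gamma1 N) 1} {ρ : GaloisRepresentations.FramedArtinRep ℚ 2},
      artinLFunction_eq_cuspFormLSeries (f := f) (ρ := ρ)) :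
    langlands_tunnell_hasEntireContinuation := by
  intro ρ hirr hodd hsolv
  obtain ⟨N, _, f, hf, hρ⟩ := hLT ρ hirr hodd hsolv
  exact hasEntireContinuation_artinLFunction_of_isGaloisRepOfNewform1 hDS hf hρ

/-- The tagged twin: **lang.S30**'s "hence" clause `hasEntireContinuation_artinLFunction_of_isSolvable ρ`
follows, for a fixed `ρ`, from `langlands_tunnell ρ` and the Deligne–Serre comparison (same
argument as `langlands_tunnell_hasEntireContinuation_of_langlands_tunnell`).
[cite: Tunnell1981, Theorem] [cite: DeligneSerreASENS1974, Thm. 4.1 and Thm. 4.6 (b)] -/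
theorem hasEntireContinuation_artinLFunction_of_isSolvable_of_langlands_tunnell
    (ρ : GaloisRepresentations.FramedArtinRep ℚ 2) (hLT : langlands_tunnell ρ)
    (hDS : ∀ {N : ℕ} [NeZero N] {f : CuspForm (Gamma1 N) 1},
      artinLFunction_eq_cuspFormLSeries (f := f) (ρ := ρ)) :
    hasEntireContinuation_artinLFunction_of_isSolvable ρ := by
  intro hirr hodd hsolv
  obtain ⟨N, _, f, hf, hρ⟩ := hLT hirr hodd hsolv
  exact hasEntireContinuation_artinLFunction_of_isGaloisRepOfNewform1 hDS hf hρ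

/-- The untagged Artin-side fact `langlands_tunnell_hasEntireContinuation` of `ArtinLFunctions`
and the tagged twin `hasEntireContinuation_artinLFunction_of_isSolvable` of `LanglandsTunnell`
are the same statement (`ρ.toGaloisRep.IsIrreducible` is by definition
`FramedRep.IsIrreducible ρ`, `FramedRep.isIrreducible_toContinuousRep_iff`); recorded so that a
discharge of either serves both. [folklore] -/
theorem langlands_tunnell_hasEntireContinuation_iff_forall :
    langlands_tunnell_hasEntireContinuation ↔
      ∀ ρ : GaloisRepresentations.FramedArtinRep ℚ 2, hasEntireContinuation_artinLFunction_of_isSolvable ρ :=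
  Iff.rfl

end Lang

end Literature.NumberTheory.Automorphic
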